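import Summits.BirchSwinnertonDyer.BirchSwinnertonDyer.Theorems.CyclotomicUntwistGNineToolkit
import HarnessLib

/-!
# (G₉) leaves: explicit good-reduction models over `ℚ(ζ₉)` for the wild Kodaira families at `3`

Helper file (theorems only, no definitions, no named fact) for the FIRST LEMMA `GNineCriterion` of
route `CyclotomicUntwist` (crux `PSRankOneLowerHalfAtThree`, item stmt-BirchSwinnertonDyer-21580,
registered line `birth`, stub `stub_gNineCriterion`; companion `CyclotomicUntwistGNineLeafIV.lean` holds the type-IV family). Setting: a number field `F`, a primitive ninth
root of unity `ζ ∈ F`, `ϖ = 1 − ζ`, `θ = 1 − 3ϖ + 6ϖ² − 7ϖ³ + 5ϖ⁴ − 2ϖ⁵` (so `ϖ⁶ = −3θ`, `θ` a unit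
at every place `w ∋ 3`), and the cubic model `y² = x³ + A₂x² + A₄x + A₆`.

For the two WILD Kodaira families at `3` with even discriminant valuation whose discriminant is a
`3`-adic square, an explicit change of variables `x = u²x' + r` over `ℤ[ζ₉]` produces a model with
`w`-integral coefficients and `w`-unit discriminant:
* `hasGoodReductionAt_leafII` — type II, `v₃(Δ) = 4`: `(A₂, A₄, A₆) = (3(3α₁ − g), 9β, 3(3γ₁ + g))`,
  `g = ±1` (the square condition is `A₆/3 ≡ −A₂/3 (mod 3)`): `u = ϖ²`, `r = gϖ²(1 + ϖ)`;
* `hasGoodReductionAt_leafIV` — type IV, `v₃(Δ) = 6`: `(A₂, A₄, A₆) = (9α, 9(3β₁ − 1), 9(3γ₁ + g))`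
  (square condition `A₄/9 ≡ −1 (mod 3)`): `u = ϖ³`, `r = −gϖ⁴ζ`;
and for the tame family
* `hasGoodReductionAt_leafI0star` — `(3B₂, 9B₄, 27B₆)` with `3 ∤ Δ(B₂, B₄, B₆)`: `u = 2ζ³ + 1`
  (`u² = −3`), `r = 0`, landing on the INTEGER model `(−B₂, B₄, −B₆)`;
together with the transports used by the descent: `hasGoodReductionAt_cubic_int_of_not_dvd`
(`3 ∤ Δ`), `hasGoodReductionAt_cubic_of_twist` / `_int_of_twist` (the `√−3`-twist
`(A₂, A₄, A₆) ↦ (−A₂/3, A₄/9, −A₆/27)`). Each integrality is an identity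
`(coefficient)·θᵏ = uᵐ·y` with `y ∈ ℤ[ϖ]`, certified by `linear_combination` against `ϖ⁶ = −3θ`
(cofactors machine-generated and kernel-checked); the unit discriminant is `16·D` with
`D ≡ 1 (mod 3)` — this is where the square condition enters. Verified numerically beforehand on
3 000 random admissible triples (folder tools of bsd-line-cycu-p1).

References: J. Tate, *Algorithm for determining the type of a singular fiber* (Antwerp IV, 1975);
A. Kraus, Manuscripta Math. 69 (1990) 353–385 (`p = 3`: `v(Δ) ≡ 0 (4) ⇒ Φ ≅ C₃`,
`v(Δ) ≡ 2 (4) ⇒ Φ ≅ C₆`); J. H. Silverman, *AEC* VII.1, VII.5.1.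
-/

set_option linter.dupNamespace false

noncomputable section

open scoped NumberField Polynomial

open WeierstrassCurve IsDedekindDomain NumberField Polynomial

namespace Summit.BirchSwinnertonDyer.BirchSwinnertonDyer.Theorems.GNine

variable {F : Type*} [Field F] [NumberField F] {ζ : F} (w : HeightOneSpectrum (𝓞 F))

/-! ### Two more valuation tools -/

/-- Every `ℤ`-polynomial expression in an element of valuation `≤ 1` has valuation `≤ 1`. [folklore] -/
theorem val_aeval_le_one_of_val_le_one {x : F} (hx : w.valuation F x ≤ 1) (p : ℤ[X]) :
    w.valuation F (aeval x p) ≤ 1 := by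
  induction p using Polynomial.induction_on' with
  | add p q hp hq =>
    rw [map_add]
    exact Valuation.map_add_le _ hp hq
  | monomial n a =>
    rw [aeval_monomial, map_mul, map_pow, algebraMap_int_eq, eq_intCast]
    exact mul_le_one' (GNineCriterion.val_intCast_le w a) (pow_le_one₀ zero_le hx)

omit [NumberField F] in
/-- Rescaling an identity: `x·t = uᵏ·y` gives `(u⁻ᵏ x)·t = y`. [folklore] -/
theorem scale_mul_eq {u x y t : F} (hu : u ≠ 0) (k : ℕ) (h : x * t = u ^ k * y) :
    u⁻¹ ^ k * x * t = y := by
  rw [mul_assoc, h, ← mul_assoc, ← mul_pow, inv_mul_cancel₀ hu, one_pow, one_mul]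

/-! ### Integer models with `3 ∤ Δ`, and the `√−3`-twist -/

/-- An integer cubic model with `3 ∤ Δ` has good reduction at every `w ∋ 3`. [folklore] -/
theorem hasGoodReductionAt_cubic_int_of_not_dvd (hw : (3 : 𝓞 F) ∈ w.asIdeal) (A₂ A₄ A₆ : ℤ)
    (h : ¬ (3 : ℤ) ∣ (⟨0, A₂, 0, A₄, A₆⟩ : WeierstrassCurve ℤ).Δ) :
    (⟨0, (A₂ : F), 0, (A₄ : F), (A₆ : F)⟩ : WeierstrassCurve F).HasGoodReductionAt w := by
  refine hasGoodReductionAt_cubic_of_val w _ _ _ (GNineCriterion.val_intCast_le w _)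
    (GNineCriterion.val_intCast_le w _) (GNineCriterion.val_intCast_le w _) ?_
  have e : (⟨0, (A₂ : F), 0, (A₄ : F), (A₆ : F)⟩ : WeierstrassCurve F).Δ =
      (((⟨0, A₂, 0, A₄, A₆⟩ : WeierstrassCurve ℤ).Δ : ℤ) : F) := by
    rw [cubic_Δ, cubic_Δ]; push_cast; ring
  rw [e]
  exact val_intCast_eq_one_of_not_dvd w hw h

/-- **The `√−3`-twist.** With `σ = 2ζ³ + 1` (`σ² = −3`), the change `(σ, 0, 0, 0)` carries
`y² = x³ + A₂x² + A₄x + A₆` to `y² = x³ − (A₂/3)x² + (A₄/9)x − A₆/27`; good reduction transports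
back. [folklore] -/
theorem hasGoodReductionAt_cubic_of_twist (hζ : IsPrimitiveRoot ζ 9) (A₂ A₄ A₆ : F)
    (h : (⟨0, -A₂ / 3, 0, A₄ / 9, -A₆ / 27⟩ : WeierstrassCurve F).HasGoodReductionAt w) :
    (⟨0, A₂, 0, A₄, A₆⟩ : WeierstrassCurve F).HasGoodReductionAt w := by
  have hσ := sigma_sq hζ
  have hσ0 := sigma_ne_zero hζ
  refine hasGoodReductionAt_cubic_of_chg w (2 * ζ ^ 3 + 1) hσ0 0 A₂ A₄ A₆ ?_
  have hs2 : (2 * ζ ^ 3 + 1 : F)⁻¹ ^ 2 = -1 / 3 := by rw [inv_pow, hσ]; norm_num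
  have hs4 : (2 * ζ ^ 3 + 1 : F)⁻¹ ^ 4 = 1 / 9 := by
    rw [show (4 : ℕ) = 2 * 2 from rfl, pow_mul, hs2]; norm_num
  have hs6 : (2 * ζ ^ 3 + 1 : F)⁻¹ ^ 6 = -1 / 27 := by
    rw [show (6 : ℕ) = 2 * 3 from rfl, pow_mul, hs2]; norm_num
  have e : (⟨0, (2 * ζ ^ 3 + 1 : F)⁻¹ ^ 2 * (A₂ + 3 * 0), 0,
      (2 * ζ ^ 3 + 1 : F)⁻¹ ^ 4 * (A₄ + 2 * 0 * A₂ + 3 * 0 ^ 2),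
      (2 * ζ ^ 3 + 1 : F)⁻¹ ^ 6 * (A₆ + 0 * A₄ + 0 ^ 2 * A₂ + 0 ^ 3)⟩ : WeierstrassCurve F) =
      ⟨0, -A₂ / 3, 0, A₄ / 9, -A₆ / 27⟩ := by
    rw [hs2, hs4, hs6]; ext <;> ring
  rw [e]; exact h

/-- The `√−3`-twist on integer models: good reduction of `(−B₂, B₄, −B₆)` gives good reduction
of `(3B₂, 9B₄, 27B₆)`. [folklore] -/
theorem hasGoodReductionAt_cubic_int_of_twist (hζ : IsPrimitiveRoot ζ 9) (B₂ B₄ B₆ : ℤ)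
    (h : (⟨0, ((-B₂ : ℤ) : F), 0, ((B₄ : ℤ) : F), ((-B₆ : ℤ) : F)⟩ :
      WeierstrassCurve F).HasGoodReductionAt w) :
    (⟨0, ((3 * B₂ : ℤ) : F), 0, ((9 * B₄ : ℤ) : F), ((27 * B₆ : ℤ) : F)⟩ :
      WeierstrassCurve F).HasGoodReductionAt w := by
  refine hasGoodReductionAt_cubic_of_twist w hζ _ _ _ ?_
  have e : (⟨0, -((3 * B₂ : ℤ) : F) / 3, 0, ((9 * B₄ : ℤ) : F) / 9, -((27 * B₆ : ℤ) : F) / 27⟩ :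
      WeierstrassCurve F) = ⟨0, ((-B₂ : ℤ) : F), 0, ((B₄ : ℤ) : F), ((-B₆ : ℤ) : F)⟩ := by
    ext <;> push_cast <;> ring
  rw [e]; exact h

/-- **Leaf I₀*.** `(3B₂, 9B₄, 27B₆)` with `3 ∤ Δ(B₂, B₄, B₆)`: the `√−3`-twist lands on the integer
model `(−B₂, B₄, −B₆)`, which has `3 ∤ Δ`. (No square condition is needed here: a type-I₀* curve at
`3` becomes good over `ℚ₃(√−3) ⊂ ℚ₃(ζ₉)`.) [folklore] -/
theorem hasGoodReductionAt_leafI0star (hζ : IsPrimitiveRoot ζ 9) (hw : (3 : 𝓞 F) ∈ w.asIdeal)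
    (B₂ B₄ B₆ : ℤ)
    (h : ¬ (3 : ℤ) ∣ (⟨0, B₂, 0, B₄, B₆⟩ : WeierstrassCurve ℤ).Δ) :
    (⟨0, ((3 * B₂ : ℤ) : F), 0, ((9 * B₄ : ℤ) : F), ((27 * B₆ : ℤ) : F)⟩ :
      WeierstrassCurve F).HasGoodReductionAt w := by
  refine hasGoodReductionAt_cubic_int_of_twist w hζ B₂ B₄ B₆ ?_
  have h' : ¬ (3 : ℤ) ∣ (⟨0, -B₂, 0, B₄, -B₆⟩ : WeierstrassCurve ℤ).Δ := by
    have e : (⟨0, -B₂, 0, B₄, -B₆⟩ : WeierstrassCurve ℤ).Δ = (⟨0, B₂, 0, B₄, B₆⟩ : WeierstrassCurve ℤ).Δ := by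
      rw [cubic_Δ, cubic_Δ]; ring
    rwa [e]
  exact hasGoodReductionAt_cubic_int_of_not_dvd w hw (-B₂) B₄ (-B₆) h'

/-- **Leaf II** (`v₃(Δ) = 4`, Kraus `Φ ≅ C₃`). For integers `α₁ β γ₁` and `g = ±1`, the cubic
`y² = x³ + 3(3α₁ − g)x² + 9βx + 3(3γ₁ + g)` acquires good reduction at every `w ∋ 3` of a number
field containing `ζ₉`: `x = ϖ⁴x' + gϖ²(1 + ϖ)`, `y = ϖ⁶y'`. [folklore] -/
theorem hasGoodReductionAt_leafII (hζ : IsPrimitiveRoot ζ 9) (hw : (3 : 𝓞 F) ∈ w.asIdeal)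
    (α₁ β γ₁ g : ℤ) (hg : g ^ 2 = 1) :
    (⟨0, ((3 * (3 * α₁ - g) : ℤ) : F), 0, ((9 * β : ℤ) : F), ((3 * (3 * γ₁ + g) : ℤ) : F)⟩ :
      WeierstrassCurve F).HasGoodReductionAt w := by
  have hϖ0 : (1 : F) - ζ ≠ 0 := one_sub_zeta_ne_zero hζ
  have h6 := varpi_pow_six hζ
  have hθ1 := val_theta_eq_one w hw hζ
  have hϖv := val_one_sub_zeta_le_one w hζ
  have hgF : (g : F) ^ 2 = 1 := by exact_mod_cast hg
  generalize (1 : F) - ζ = ϖ at hϖ0 h6 hθ1 hϖv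
  have hu : ϖ ^ 2 ≠ 0 := pow_ne_zero _ hϖ0
  have h24 : ϖ ^ 24 = 81 * (1 - 3 * ϖ + 6 * ϖ ^ 2 - 7 * ϖ ^ 3 + 5 * ϖ ^ 4 - 2 * ϖ ^ 5) ^ 4 := by
    linear_combination (ϖ ^ 18 - 3 * (1 - 3 * ϖ + 6 * ϖ ^ 2 - 7 * ϖ ^ 3 + 5 * ϖ ^ 4 - 2 * ϖ ^ 5) * ϖ ^ 12 + 9 * (1 - 3 * ϖ + 6 * ϖ ^ 2 - 7 * ϖ ^ 3 + 5 * ϖ ^ 4 - 2 * ϖ ^ 5) ^ 2 * ϖ ^ 6 - 27 * (1 - 3 * ϖ + 6 * ϖ ^ 2 - 7 * ϖ ^ 3 + 5 * ϖ ^ 4 - 2 * ϖ ^ 5) ^ 3) * h6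
  push_cast
  refine hasGoodReductionAt_cubic_of_model w (ϖ ^ 2) hu ((g : F) * ϖ ^ 2 * (1 + ϖ)) _ _ _ ?_ ?_ ?_ ?_
  · -- coefficient `2`: `(…)·θ^1 = u^2·y`, `y ∈ ℤ[ϖ]`
    refine val_le_one_of_mul_unit_pow w hθ1 1
      (y := (((-3 : ℤ) : F) * ϖ ^ 2 * (α₁ : F) + ((1 : ℤ) : F) * ϖ ^ 2 * (g : F)
            + ((-1 : ℤ) : F) * ϖ ^ 4 * (g : F) + ((-1 : ℤ) : F) * ϖ ^ 5 * (g : F))) ?_ ?_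
    · refine scale_mul_eq hu 2 ?_
      push_cast
      linear_combination (((3 : F) * (α₁ : F) + (-1 : F) * (g : F) + (1 : F) * ϖ ^ 2 * (g : F)
        + (1 : F) * ϖ ^ 3 * (g : F))) * h6
        + ((0 : F)) * hgF
    · have e : (((-3 : ℤ) : F) * ϖ ^ 2 * (α₁ : F) + ((1 : ℤ) : F) * ϖ ^ 2 * (g : F)
          + ((-1 : ℤ) : F) * ϖ ^ 4 * (g : F) + ((-1 : ℤ) : F) * ϖ ^ 5 * (g : F)) =
          aeval ϖ ((((-3 : ℤ) : ℤ[X]) * X ^ 2 * (α₁ : ℤ[X]) + ((1 : ℤ) : ℤ[X]) * X ^ 2 * (g : ℤ[X])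
            + ((-1 : ℤ) : ℤ[X]) * X ^ 4 * (g : ℤ[X]) + ((-1 : ℤ) : ℤ[X]) * X ^ 5 * (g : ℤ[X])) : ℤ[X]) := by
        simp only [map_add, map_mul, map_pow, aeval_X, map_intCast]
      rw [e]; exact val_aeval_le_one_of_val_le_one w hϖv _
  · -- coefficient `4`: `(…)·θ^2 = u^4·y`, `y ∈ ℤ[ϖ]`
    refine val_le_one_of_mul_unit_pow w hθ1 2
      (y := (((-6 : ℤ) : F) * (g : F) * (α₁ : F) + ((2 : ℤ) : F) * (g : F) ^ 2
            + ((12 : ℤ) : F) * ϖ * (g : F) * (α₁ : F) + ((-4 : ℤ) : F) * ϖ * (g : F) ^ 2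
            + ((-1 : ℤ) : F) * ϖ ^ 2 + ((-18 : ℤ) : F) * ϖ ^ 2 * (g : F) * (α₁ : F)
            + ((6 : ℤ) : F) * ϖ ^ 2 * (g : F) ^ 2 + ((1 : ℤ) : F) * ϖ ^ 3
            + ((6 : ℤ) : F) * ϖ ^ 3 * (g : F) * (α₁ : F) + ((-2 : ℤ) : F) * ϖ ^ 3 * (g : F) ^ 2
            + ((-1 : ℤ) : F) * ϖ ^ 4 + ((1 : ℤ) : F) * ϖ ^ 4 * (β : F)
            + ((12 : ℤ) : F) * ϖ ^ 4 * (g : F) * (α₁ : F) + ((-4 : ℤ) : F) * ϖ ^ 4 * (g : F) ^ 2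
            + ((-2 : ℤ) : F) * ϖ ^ 5 + ((-18 : ℤ) : F) * ϖ ^ 5 * (g : F) * (α₁ : F)
            + ((6 : ℤ) : F) * ϖ ^ 5 * (g : F) ^ 2 + ((3 : ℤ) : F) * ϖ ^ 6
            + ((12 : ℤ) : F) * ϖ ^ 6 * (g : F) * (α₁ : F) + ((-4 : ℤ) : F) * ϖ ^ 6 * (g : F) ^ 2
            + ((-1 : ℤ) : F) * ϖ ^ 7 + ((-1 : ℤ) : F) * ϖ ^ 8 + ((2 : ℤ) : F) * ϖ ^ 9)) ?_ ?_
    · refine scale_mul_eq hu 4 ?_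
      push_cast
      linear_combination (((3 : F) * (β : F) + (-9 : F) * ϖ * (β : F) + (-2 : F) * ϖ ^ 2
        + (18 : F) * ϖ ^ 2 * (β : F) + (6 : F) * ϖ ^ 2 * (g : F) * (α₁ : F) + (4 : F) * ϖ ^ 3
        + (-21 : F) * ϖ ^ 3 * (β : F) + (-12 : F) * ϖ ^ 3 * (g : F) * (α₁ : F) + (-5 : F) * ϖ ^ 4
        + (15 : F) * ϖ ^ 4 * (β : F) + (18 : F) * ϖ ^ 4 * (g : F) * (α₁ : F) + (1 : F) * ϖ ^ 5
        + (-6 : F) * ϖ ^ 5 * (β : F) + (-6 : F) * ϖ ^ 5 * (g : F) * (α₁ : F) + (5 : F) * ϖ ^ 6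
        + (-1 : F) * ϖ ^ 6 * (β : F) + (-12 : F) * ϖ ^ 6 * (g : F) * (α₁ : F) + (-4 : F) * ϖ ^ 7
        + (18 : F) * ϖ ^ 7 * (g : F) * (α₁ : F) + (1 : F) * ϖ ^ 8
        + (-12 : F) * ϖ ^ 8 * (g : F) * (α₁ : F) + (1 : F) * ϖ ^ 9 + (1 : F) * ϖ ^ 10
        + (-2 : F) * ϖ ^ 11)) * h6
        + (((-6 : F) * ϖ ^ 2 + (30 : F) * ϖ ^ 3 + (-87 : F) * ϖ ^ 4 + (162 : F) * ϖ ^ 5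
          + (-198 : F) * ϖ ^ 6 + (138 : F) * ϖ ^ 7 + (7 : F) * ϖ ^ 8 + (-134 : F) * ϖ ^ 9
          + (159 : F) * ϖ ^ 10 + (-106 : F) * ϖ ^ 11 + (58 : F) * ϖ ^ 12 + (-54 : F) * ϖ ^ 13
          + (55 : F) * ϖ ^ 14 + (-36 : F) * ϖ ^ 15 + (12 : F) * ϖ ^ 16)) * hgF
    · have e : (((-6 : ℤ) : F) * (g : F) * (α₁ : F) + ((2 : ℤ) : F) * (g : F) ^ 2
          + ((12 : ℤ) : F) * ϖ * (g : F) * (α₁ : F) + ((-4 : ℤ) : F) * ϖ * (g : F) ^ 2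
          + ((-1 : ℤ) : F) * ϖ ^ 2 + ((-18 : ℤ) : F) * ϖ ^ 2 * (g : F) * (α₁ : F)
          + ((6 : ℤ) : F) * ϖ ^ 2 * (g : F) ^ 2 + ((1 : ℤ) : F) * ϖ ^ 3
          + ((6 : ℤ) : F) * ϖ ^ 3 * (g : F) * (α₁ : F) + ((-2 : ℤ) : F) * ϖ ^ 3 * (g : F) ^ 2
          + ((-1 : ℤ) : F) * ϖ ^ 4 + ((1 : ℤ) : F) * ϖ ^ 4 * (β : F)
          + ((12 : ℤ) : F) * ϖ ^ 4 * (g : F) * (α₁ : F) + ((-4 : ℤ) : F) * ϖ ^ 4 * (g : F) ^ 2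
          + ((-2 : ℤ) : F) * ϖ ^ 5 + ((-18 : ℤ) : F) * ϖ ^ 5 * (g : F) * (α₁ : F)
          + ((6 : ℤ) : F) * ϖ ^ 5 * (g : F) ^ 2 + ((3 : ℤ) : F) * ϖ ^ 6
          + ((12 : ℤ) : F) * ϖ ^ 6 * (g : F) * (α₁ : F) + ((-4 : ℤ) : F) * ϖ ^ 6 * (g : F) ^ 2
          + ((-1 : ℤ) : F) * ϖ ^ 7 + ((-1 : ℤ) : F) * ϖ ^ 8 + ((2 : ℤ) : F) * ϖ ^ 9) =
          aeval ϖ ((((-6 : ℤ) : ℤ[X]) * (g : ℤ[X]) * (α₁ : ℤ[X]) + ((2 : ℤ) : ℤ[X]) * (g : ℤ[X]) ^ 2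
            + ((12 : ℤ) : ℤ[X]) * X * (g : ℤ[X]) * (α₁ : ℤ[X])
            + ((-4 : ℤ) : ℤ[X]) * X * (g : ℤ[X]) ^ 2 + ((-1 : ℤ) : ℤ[X]) * X ^ 2
            + ((-18 : ℤ) : ℤ[X]) * X ^ 2 * (g : ℤ[X]) * (α₁ : ℤ[X])
            + ((6 : ℤ) : ℤ[X]) * X ^ 2 * (g : ℤ[X]) ^ 2 + ((1 : ℤ) : ℤ[X]) * X ^ 3
            + ((6 : ℤ) : ℤ[X]) * X ^ 3 * (g : ℤ[X]) * (α₁ : ℤ[X])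
            + ((-2 : ℤ) : ℤ[X]) * X ^ 3 * (g : ℤ[X]) ^ 2 + ((-1 : ℤ) : ℤ[X]) * X ^ 4
            + ((1 : ℤ) : ℤ[X]) * X ^ 4 * (β : ℤ[X])
            + ((12 : ℤ) : ℤ[X]) * X ^ 4 * (g : ℤ[X]) * (α₁ : ℤ[X])
            + ((-4 : ℤ) : ℤ[X]) * X ^ 4 * (g : ℤ[X]) ^ 2 + ((-2 : ℤ) : ℤ[X]) * X ^ 5
            + ((-18 : ℤ) : ℤ[X]) * X ^ 5 * (g : ℤ[X]) * (α₁ : ℤ[X])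
            + ((6 : ℤ) : ℤ[X]) * X ^ 5 * (g : ℤ[X]) ^ 2 + ((3 : ℤ) : ℤ[X]) * X ^ 6
            + ((12 : ℤ) : ℤ[X]) * X ^ 6 * (g : ℤ[X]) * (α₁ : ℤ[X])
            + ((-4 : ℤ) : ℤ[X]) * X ^ 6 * (g : ℤ[X]) ^ 2 + ((-1 : ℤ) : ℤ[X]) * X ^ 7
            + ((-1 : ℤ) : ℤ[X]) * X ^ 8 + ((2 : ℤ) : ℤ[X]) * X ^ 9) : ℤ[X]) := by
        simp only [map_add, map_mul, map_pow, aeval_X, map_intCast]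
      rw [e]; exact val_aeval_le_one_of_val_le_one w hϖv _
  · -- coefficient `6`: `(…)·θ^2 = u^6·y`, `y ∈ ℤ[ϖ]`
    refine val_le_one_of_mul_unit_pow w hθ1 2
      (y := (((1 : ℤ) : F) * (γ₁ : F) + ((3 : ℤ) : F) * (g : F) + ((-10 : ℤ) : F) * ϖ * (g : F)
            + ((19 : ℤ) : F) * ϖ ^ 2 * (g : F) + ((1 : ℤ) : F) * ϖ ^ 2 * (g : F) * (β : F)
            + ((-22 : ℤ) : F) * ϖ ^ 3 * (g : F) + ((1 : ℤ) : F) * ϖ ^ 3 * (g : F) * (β : F)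
            + ((1 : ℤ) : F) * ϖ ^ 4 * (α₁ : F) + ((10 : ℤ) : F) * ϖ ^ 4 * (g : F)
            + ((2 : ℤ) : F) * ϖ ^ 5 * (α₁ : F) + ((3 : ℤ) : F) * ϖ ^ 5 * (g : F)
            + ((1 : ℤ) : F) * ϖ ^ 6 * (α₁ : F) + ((-8 : ℤ) : F) * ϖ ^ 6 * (g : F)
            + ((4 : ℤ) : F) * ϖ ^ 7 * (g : F))) ?_ ?_
    · refine scale_mul_eq hu 6 ?_
      push_cast
      linear_combination (((3 : F) * (γ₁ : F) + (1 : F) * (g : F) + (-9 : F) * ϖ * (γ₁ : F) + (-3 : F) * ϖ * (g : F)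
        + (18 : F) * ϖ ^ 2 * (γ₁ : F) + (6 : F) * ϖ ^ 2 * (g : F)
        + (3 : F) * ϖ ^ 2 * (g : F) * (β : F) + (-21 : F) * ϖ ^ 3 * (γ₁ : F)
        + (-7 : F) * ϖ ^ 3 * (g : F) + (-6 : F) * ϖ ^ 3 * (g : F) * (β : F)
        + (15 : F) * ϖ ^ 4 * (γ₁ : F) + (3 : F) * ϖ ^ 4 * (α₁ : F) + (4 : F) * ϖ ^ 4 * (g : F)
        + (9 : F) * ϖ ^ 4 * (g : F) * (β : F) + (-6 : F) * ϖ ^ 5 * (γ₁ : F)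
        + (-3 : F) * ϖ ^ 5 * (α₁ : F) + (-1 : F) * ϖ ^ 5 * (g : F)
        + (-3 : F) * ϖ ^ 5 * (g : F) * (β : F) + (-1 : F) * ϖ ^ 6 * (γ₁ : F)
        + (3 : F) * ϖ ^ 6 * (α₁ : F) + (-1 : F) * ϖ ^ 6 * (g : F)
        + (-6 : F) * ϖ ^ 6 * (g : F) * (β : F) + (6 : F) * ϖ ^ 7 * (α₁ : F)
        + (-2 : F) * ϖ ^ 7 * (g : F) + (9 : F) * ϖ ^ 7 * (g : F) * (β : F)
        + (-9 : F) * ϖ ^ 8 * (α₁ : F) + (3 : F) * ϖ ^ 8 * (g : F)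
        + (-7 : F) * ϖ ^ 8 * (g : F) * (β : F) + (3 : F) * ϖ ^ 9 * (α₁ : F)
        + (-1 : F) * ϖ ^ 9 * (g : F) * (β : F) + (2 : F) * ϖ ^ 10 * (α₁ : F)
        + (-1 : F) * ϖ ^ 10 * (g : F) + (-8 : F) * ϖ ^ 11 * (α₁ : F) + (2 : F) * ϖ ^ 11 * (g : F)
        + (-1 : F) * ϖ ^ 12 * (α₁ : F))) * h6
        + (((9 : F) * ϖ ^ 4 * (α₁ : F) + (-3 : F) * ϖ ^ 4 * (g : F) + (-36 : F) * ϖ ^ 5 * (α₁ : F)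
          + (12 : F) * ϖ ^ 5 * (g : F) + (90 : F) * ϖ ^ 6 * (α₁ : F) + (-29 : F) * ϖ ^ 6 * (g : F)
          + (-126 : F) * ϖ ^ 7 * (α₁ : F) + (39 : F) * ϖ ^ 7 * (g : F)
          + (81 : F) * ϖ ^ 8 * (α₁ : F) + (-21 : F) * ϖ ^ 8 * (g : F)
          + (72 : F) * ϖ ^ 9 * (α₁ : F) + (-28 : F) * ϖ ^ 9 * (g : F)
          + (-243 : F) * ϖ ^ 10 * (α₁ : F) + (76 : F) * ϖ ^ 10 * (g : F)
          + (270 : F) * ϖ ^ 11 * (α₁ : F) + (-73 : F) * ϖ ^ 11 * (g : F)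
          + (-126 : F) * ϖ ^ 12 * (α₁ : F) + (23 : F) * ϖ ^ 12 * (g : F)
          + (-72 : F) * ϖ ^ 13 * (α₁ : F) + (27 : F) * ϖ ^ 13 * (g : F)
          + (153 : F) * ϖ ^ 14 * (α₁ : F) + (-35 : F) * ϖ ^ 14 * (g : F)
          + (-108 : F) * ϖ ^ 15 * (α₁ : F) + (14 : F) * ϖ ^ 15 * (g : F)
          + (36 : F) * ϖ ^ 16 * (α₁ : F) + (-3 : F) * ϖ ^ 16 * (g : F)
          + (5 : F) * ϖ ^ 17 * (g : F) + (-8 : F) * ϖ ^ 18 * (g : F) + (4 : F) * ϖ ^ 19 * (g : F))) * hgF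
    · have e : (((1 : ℤ) : F) * (γ₁ : F) + ((3 : ℤ) : F) * (g : F) + ((-10 : ℤ) : F) * ϖ * (g : F)
          + ((19 : ℤ) : F) * ϖ ^ 2 * (g : F) + ((1 : ℤ) : F) * ϖ ^ 2 * (g : F) * (β : F)
          + ((-22 : ℤ) : F) * ϖ ^ 3 * (g : F) + ((1 : ℤ) : F) * ϖ ^ 3 * (g : F) * (β : F)
          + ((1 : ℤ) : F) * ϖ ^ 4 * (α₁ : F) + ((10 : ℤ) : F) * ϖ ^ 4 * (g : F)
          + ((2 : ℤ) : F) * ϖ ^ 5 * (α₁ : F) + ((3 : ℤ) : F) * ϖ ^ 5 * (g : F)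
          + ((1 : ℤ) : F) * ϖ ^ 6 * (α₁ : F) + ((-8 : ℤ) : F) * ϖ ^ 6 * (g : F)
          + ((4 : ℤ) : F) * ϖ ^ 7 * (g : F)) =
          aeval ϖ ((((1 : ℤ) : ℤ[X]) * (γ₁ : ℤ[X]) + ((3 : ℤ) : ℤ[X]) * (g : ℤ[X])
            + ((-10 : ℤ) : ℤ[X]) * X * (g : ℤ[X]) + ((19 : ℤ) : ℤ[X]) * X ^ 2 * (g : ℤ[X])
            + ((1 : ℤ) : ℤ[X]) * X ^ 2 * (g : ℤ[X]) * (β : ℤ[X])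
            + ((-22 : ℤ) : ℤ[X]) * X ^ 3 * (g : ℤ[X])
            + ((1 : ℤ) : ℤ[X]) * X ^ 3 * (g : ℤ[X]) * (β : ℤ[X])
            + ((1 : ℤ) : ℤ[X]) * X ^ 4 * (α₁ : ℤ[X]) + ((10 : ℤ) : ℤ[X]) * X ^ 4 * (g : ℤ[X])
            + ((2 : ℤ) : ℤ[X]) * X ^ 5 * (α₁ : ℤ[X]) + ((3 : ℤ) : ℤ[X]) * X ^ 5 * (g : ℤ[X])
            + ((1 : ℤ) : ℤ[X]) * X ^ 6 * (α₁ : ℤ[X]) + ((-8 : ℤ) : ℤ[X]) * X ^ 6 * (g : ℤ[X])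
            + ((4 : ℤ) : ℤ[X]) * X ^ 7 * (g : ℤ[X])) : ℤ[X]) := by
        simp only [map_add, map_mul, map_pow, aeval_X, map_intCast]
      rw [e]; exact val_aeval_le_one_of_val_le_one w hϖv _
  · -- discriminant: `16Δ₀·θ^4 = u¹²·(16·D)` with `D ≡ 1 (mod 3)`
    rw [cubic_Δ]
    refine val_eq_one_of_mul_unit_pow w hθ1 4
      (y := (((16 * ((-27 : ℤ) * γ₁ ^ 2 + (-36 : ℤ) * β ^ 3 + (162 : ℤ) * α₁ * β * γ₁
              + (81 : ℤ) * α₁ ^ 2 * β ^ 2 + (-324 : ℤ) * α₁ ^ 3 * γ₁ + (-18 : ℤ) * g * γ₁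
              + (-54 : ℤ) * g * β * γ₁ + (54 : ℤ) * g * α₁ * β + (-54 : ℤ) * g * α₁ * β ^ 2
              + (324 : ℤ) * g * α₁ ^ 2 * γ₁ + (-108 : ℤ) * g * α₁ ^ 3 + (-3 : ℤ) * g ^ 2
              + (-18 : ℤ) * g ^ 2 * β + (9 : ℤ) * g ^ 2 * β ^ 2 + (-108 : ℤ) * g ^ 2 * α₁ * γ₁
              + (108 : ℤ) * g ^ 2 * α₁ ^ 2 + (12 : ℤ) * g ^ 3 * γ₁ + (-36 : ℤ) * g ^ 3 * α₁
              + (4 : ℤ) * g ^ 4) : ℤ) : ℤ) : F)) ?_ ?_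
    · refine scale_mul_eq hu 12 ?_
      push_cast
      linear_combination (-(16 : F) * ((-27 : F) * (γ₁ : F) ^ 2 + (-36 : F) * (β : F) ^ 3
        + (162 : F) * (α₁ : F) * (β : F) * (γ₁ : F) + (81 : F) * (α₁ : F) ^ 2 * (β : F) ^ 2
        + (-324 : F) * (α₁ : F) ^ 3 * (γ₁ : F) + (-18 : F) * (g : F) * (γ₁ : F)
        + (-54 : F) * (g : F) * (β : F) * (γ₁ : F) + (54 : F) * (g : F) * (α₁ : F) * (β : F)
        + (-54 : F) * (g : F) * (α₁ : F) * (β : F) ^ 2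
        + (324 : F) * (g : F) * (α₁ : F) ^ 2 * (γ₁ : F) + (-108 : F) * (g : F) * (α₁ : F) ^ 3
        + (-3 : F) * (g : F) ^ 2 + (-18 : F) * (g : F) ^ 2 * (β : F)
        + (9 : F) * (g : F) ^ 2 * (β : F) ^ 2 + (-108 : F) * (g : F) ^ 2 * (α₁ : F) * (γ₁ : F)
        + (108 : F) * (g : F) ^ 2 * (α₁ : F) ^ 2 + (12 : F) * (g : F) ^ 3 * (γ₁ : F)
        + (-36 : F) * (g : F) ^ 3 * (α₁ : F) + (4 : F) * (g : F) ^ 4)) * h24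
    · refine val_intCast_eq_one_of_not_dvd w hw ?_
      obtain ⟨Q, hQ⟩ : ∃ Q : ℤ, ((-27 : ℤ) * γ₁ ^ 2 + (-36 : ℤ) * β ^ 3 + (162 : ℤ) * α₁ * β * γ₁
          + (81 : ℤ) * α₁ ^ 2 * β ^ 2 + (-324 : ℤ) * α₁ ^ 3 * γ₁ + (-18 : ℤ) * g * γ₁
          + (-54 : ℤ) * g * β * γ₁ + (54 : ℤ) * g * α₁ * β + (-54 : ℤ) * g * α₁ * β ^ 2
          + (324 : ℤ) * g * α₁ ^ 2 * γ₁ + (-108 : ℤ) * g * α₁ ^ 3 + (-3 : ℤ) * g ^ 2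
          + (-18 : ℤ) * g ^ 2 * β + (9 : ℤ) * g ^ 2 * β ^ 2 + (-108 : ℤ) * g ^ 2 * α₁ * γ₁
          + (108 : ℤ) * g ^ 2 * α₁ ^ 2 + (12 : ℤ) * g ^ 3 * γ₁ + (-36 : ℤ) * g ^ 3 * α₁
          + (4 : ℤ) * g ^ 4) = 3 * Q + 1 :=
        ⟨((-9 : ℤ) * γ₁ ^ 2 + (-6 : ℤ) * β + (3 : ℤ) * β ^ 2 + (-12 : ℤ) * β ^ 3
          + (-36 : ℤ) * α₁ * γ₁ + (54 : ℤ) * α₁ * β * γ₁ + (36 : ℤ) * α₁ ^ 2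
          + (27 : ℤ) * α₁ ^ 2 * β ^ 2 + (-108 : ℤ) * α₁ ^ 3 * γ₁ + (-2 : ℤ) * g * γ₁
          + (-18 : ℤ) * g * β * γ₁ + (-12 : ℤ) * g * α₁ + (18 : ℤ) * g * α₁ * β
          + (-18 : ℤ) * g * α₁ * β ^ 2 + (108 : ℤ) * g * α₁ ^ 2 * γ₁ + (-36 : ℤ) * g * α₁ ^ 3), by linear_combination (((1 : ℤ) + (-18 : ℤ) * β + (9 : ℤ) * β ^ 2 + (-108 : ℤ) * α₁ * γ₁ + (108 : ℤ) * α₁ ^ 2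
            + (12 : ℤ) * g * γ₁ + (-36 : ℤ) * g * α₁ + (4 : ℤ) * g ^ 2)) * hg⟩
      rw [hQ]; omega

end Summit.BirchSwinnertonDyer.BirchSwinnertonDyer.Theorems.GNine

end
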